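import Mathlib
import Summits.Schanuel.Schanuel.Theses.ExpMordellWeil
import Summits.Schanuel.Schanuel.Theses.LogPatterns
import Literature.NumberTheory.Transcendental.SchanuelSectorSplit
import HarnessLib

/-!
# Crux `RankLeTrdeg` (stmt-Schanuel-3486) — the strategist's typed split into two leaves

Route `ExpMordellWeil` (sub-problem `Schanuel/Schanuel`); deciding crux
`Summit.Schanuel.Schanuel.Theses.ExpMordellWeil.RankLeTrdeg`
(X: for every subfield `K ≤ ℂ`, every `ℚ`-linearly independent family `u₁,…,uₙ ∈ Γ(K) = {u ∈ K : e^u ∈ K}`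
has `n ≤ trdeg_ℚ K`; X ⟺ Schanuel, so the route re-audit binned it RESTATED).
Seat `planner-cstrat-stmt-Schanuel-3486-r1-0` (crux-strategist, BC2 redirect).

The split is the SECTOR FACTORISATION of X at the `ℚ`-subspace `𝓛 = exp⁻¹(ℚ̄) = {z : e^z algebraic}`
(the logarithms of algebraic numbers; a `ℚ`-subspace by
`Literature.NumberTheory.Transcendental.span_setOf_isAlgebraic_exp`):

* LEAF 1 `LogSector` — algebraic independence of `ℚ`-linearly independent logarithms of algebraic numbers
  (= `Literature.Barriers.Schanuel.AlgIndepLogarithms`; ledger item stmt-Schanuel-4310, shared with the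
  routes LogPatterns / MatrixCoefficients). In the route's Mordell–Weil dictionary: the rank bound for the
  CONSTANT part `Γ(K) ∩ 𝓛` of the exponential Mordell–Weil group ("rank of the trace part ≤ dimension").
* LEAF 2 `OffLogSector` — Schanuel RELATIVE to the field of logarithms `K₀ = ℚ(𝓛)`: tuples `ℚ`-independent
  modulo `𝓛` have `trdeg_{K₀} K₀(x, eˣ) ≥ |x|` (ledger item stmt-Schanuel-4311, shared with LogPatterns /
  MatrixCoefficients). In the dictionary: the Lang–Néron RELATIVE rank bound
  `rank (Γ(K) / Γ(K) ∩ 𝓛) ≤ trdeg (K·K₀ / K₀)` over the constant field `K₀`.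

Glue `rankLeTrdeg_of_subs : LogSector → OffLogSector → RankLeTrdeg` (sorry-free): Kirby's
`GL_n(ℚ)`-adapted-basis bookkeeping + tower law + base change, i.e. the tree theorem
`Literature.NumberTheory.Transcendental.schanuel_of_sector_split_set` at `S = 𝓛` (its ~100-line proof and
the ~80-line `le_trdeg_adjoin_of_mem_span_of_algebraicIndependent` are the mathematical content of the
seam), fed on the inside by LEAF 1 through `le_trdeg_adjoin_of_algebraicIndependent'`, on the outside by
LEAF 2 verbatim, and followed by monotonicity of `Algebra.trdeg` along `ℚ(u, e^u) ≤ K`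
(`rankLeTrdeg_of_schanuel`). Neither leaf mentions the other, `Γ(K)`, or the summit; neither is the crux
reworded: LEAF 1 is the catalogued barrier conjecture `AlgIndepLogarithms` (strictly below Schanuel as far
as anyone knows), LEAF 2 says nothing about tuples inside `𝓛` and implies Schanuel only together with LEAF 1.
The converse directions (X ⇒ each leaf) are `Literature.Barriers.Schanuel.algIndepLogarithms_of_schanuel`
(tree) and LogPatterns' support item `OffLogSectorOfSchanuel` (stmt-Schanuel-4316): the split loses nothing.
Nothing here closes or refutes stmt-Schanuel-3486.
-/

noncomputable section

-- `Summit.Schanuel.Schanuel.…` is the mandated summit/sub-problem namespace (single-conjunct summit), hence: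
set_option linter.dupNamespace false

namespace Summit.Schanuel.Schanuel.Cruxes.RankLeTrdeg.Split

open IntermediateField
open Summit.Schanuel.Schanuel.Theses.ExpMordellWeil (RankLeTrdeg)
open Summit.Schanuel.Schanuel.Theses.LogPatterns (LogSector OffLogSector)
open Literature.NumberTheory.Transcendental
  (SchanuelRank schanuel_of_sector_split_set le_trdeg_adjoin_of_algebraicIndependent'
    isAlgebraic_exp_of_mem_span)

/-! ## Monotonicity: Schanuel ⇒ X (the route's support item `SchanuelImpliesRankLeTrdeg`, inlined) -/

/-- Schanuel's conjecture implies the exponential Mordell–Weil rank bound `RankLeTrdeg`: apply Schanuel to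
`u` and push the bound along `ℚ(u, e^u) ≤ K` (`trdeg_le_of_injective` with the inclusion). -/
theorem rankLeTrdeg_of_schanuel (hS : _root_.Schanuel) : RankLeTrdeg := by
  intro K n u hu hli
  have h : (n : Cardinal) ≤
      Algebra.trdeg ℚ ↥(adjoin ℚ (Set.range u ∪ Set.range (Complex.exp ∘ u))) := hS n u hli
  have hle : adjoin ℚ (Set.range u ∪ Set.range (Complex.exp ∘ u)) ≤ K := by
    rw [adjoin_le_iff]
    rintro a (⟨i, rfl⟩ | ⟨i, rfl⟩)
    · exact (hu i).1
    · exact (hu i).2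
  exact h.trans (trdeg_le_of_injective (inclusion hle) (inclusion_injective hle))

/-! ## The glue: LEAF 1 → LEAF 2 → Schanuel → X -/

/-- Inside the sector: under LEAF 1 (`LogPatterns.LogSector`, item stmt-Schanuel-4310), every
`ℚ`-linearly independent tuple `y` from `span_ℚ 𝓛 = 𝓛` generates a field of transcendence degree `≥ |y|`
(LEAF 1 makes `y` algebraically independent; `le_trdeg_adjoin_of_algebraicIndependent'`). -/
theorem inside_of_logSector (h₁ : LogSector) :
    ∀ (k : ℕ) (y : Fin k → ℂ), (∀ i, y i ∈ Submodule.span ℚ {z : ℂ | IsAlgebraic ℚ (Complex.exp z)}) →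
      LinearIndependent ℚ y → (k : Cardinal) ≤ Algebra.trdeg ℚ ↥(adjoin ℚ (Set.range y)) := by
  intro k y hy hli
  have halg : ∀ i, IsAlgebraic ℚ (Complex.exp (y i)) := fun i => isAlgebraic_exp_of_mem_span (hy i)
  simpa using le_trdeg_adjoin_of_algebraicIndependent' (h₁ k y halg hli)

/-- The sector factorisation of Schanuel's conjecture at `𝓛`: LEAF 1 ∧ LEAF 2 ⇒ Schanuel
(`schanuel_of_sector_split_set` at `S = 𝓛`, LEAF 2 = `LogPatterns.OffLogSector`, item stmt-Schanuel-4311,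
feeding its outside hypothesis verbatim; `∀ n, SchanuelRank n` is `Schanuel` by `Iff.rfl`). This is the
content of LogPatterns' open assembly item stmt-Schanuel-4317. -/
theorem schanuel_of_logSector_offLogSector (h₁ : LogSector) (h₂ : OffLogSector) : _root_.Schanuel := by
  have key : ∀ n, SchanuelRank n :=
    schanuel_of_sector_split_set {z : ℂ | IsAlgebraic ℚ (Complex.exp z)} (inside_of_logSector h₁) h₂
  exact fun n z hz => key n z hz

/-- **The typed split of the crux** (BC2 redirect), hypotheses = the two leaves WRITTEN OUT exactly as they
are filed as children of `RankLeTrdeg` in the route file (and as `LogPatterns.LogSector` /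
`LogPatterns.OffLogSector`), conclusion = the crux decl by name. -/
theorem rankLeTrdeg_of_subs
    (h₁ : ∀ (n : ℕ) (l : Fin n → ℂ), (∀ i, IsAlgebraic ℚ (Complex.exp (l i))) → LinearIndependent ℚ l →
      AlgebraicIndependent ℚ l)
    (h₂ : ∀ (n : ℕ) (x : Fin n → ℂ),
      LinearIndependent ℚ ((Submodule.span ℚ {z : ℂ | IsAlgebraic ℚ (Complex.exp z)}).mkQ ∘ x) →
        (n : Cardinal) ≤ Algebra.trdeg ↥(IntermediateField.adjoin ℚ {z : ℂ | IsAlgebraic ℚ (Complex.exp z)})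
          ↥(IntermediateField.adjoin ↥(IntermediateField.adjoin ℚ {z : ℂ | IsAlgebraic ℚ (Complex.exp z)})
            (Set.range x ∪ Set.range (Complex.exp ∘ x)))) :
    RankLeTrdeg :=
  rankLeTrdeg_of_schanuel (schanuel_of_logSector_offLogSector h₁ h₂)

/-- The same glue with the hypotheses named by the shared LogPatterns decls (items 4310, 4311). -/
theorem rankLeTrdeg_of_logSector_offLogSector (h₁ : LogSector) (h₂ : OffLogSector) : RankLeTrdeg :=
  rankLeTrdeg_of_subs h₁ h₂

end Summit.Schanuel.Schanuel.Cruxes.RankLeTrdeg.Split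

end
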